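import Mathlib
import Summits.Ventures.PercRepro2.HCov
import Summits.Ventures.PercRepro2.HCovCubic
import Summits.Ventures.PercRepro2.TriDisagreement
import Summits.Ventures.PercRepro2.TriDisagreementPinned
import Summits.Ventures.PercRepro2.TypedSplit
import Summits.Ventures.PercRepro2.OneTypedEdge
import Summits.Ventures.PercRepro2.StarPattern
import Summits.Ventures.PercRepro2.StarIdentities

/-!
# The located hard step: the debt identities of the out-of-cone degree-three stars (blind cell
PercRepro2, p1 g11; ASSIGNMENTS v12.26 (6) / v12.27 (6′) — «the (2,2,1)-debt inequality in
`patCount` terms over `StarData`, as a named Lean statement»)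

With the genuine two-hyperedge bases `Btwo P Q` (the blocks `P`, `Q` placed independently in one
copy each — in the same copy they merge into `P ∪ Q`, as `starSet` does automatically) and the
type-`2` hyperedge base `Btype2 P` (the block `P` open in exactly two copies), the out-of-cone
cells of the lead's degree-three star cone satisfy the DEBT IDENTITIES (LEAD-CCW §3⁗⁗″):

* **`star_212`** (root type `2`, the other edges of types `1` and `2`):
  `N_(2,1,2) + B(T₁) = B(01₁,02₁) + B(02₁,T₁) + B(02₂) + B(02₁,12₁)`;
* **`star_122`** (root type `1`, both other edges of type `2`):
  `N_(1,2,2) + B(T₁) = B(01₁,12₁) + B(12₁,T₁) + B(02₁,12₁) + B(12₂)`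

(`0` = the root edge `s₁`, `1` = `s₂`, `2` = `s₃`, `T = 012`). So the HARD STEP of the residual
map — `N ≥ 0` at these cells — is exactly the inequality «the four hypergraph bases one vertex
down dominate the debt `B(T₁)`» (**`HardStep212`**, **`HardStep122`**;
`typedCount_212_nonneg_iff`, `typedCount_122_nonneg_iff`): a named statement, not a proof.
The hub family (NEG-101) shows that no constant can be put in front of the debt.
-/

namespace Summit.Ventures.PercRepro2

open CovForm CovForm.OneTyped CovForm.TypedRed

namespace StarPattern

section Defs

variable {V : Type*} {E : Type*} [Fintype E] [DecidableEq E] {R : Type*} [Field R]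

/-- Componentwise `or` of two star patterns (two blocks in the same copy merge). -/
def orU (P Q : Bool × Bool × Bool) : Bool × Bool × Bool := (P.1 || Q.1, P.2.1 || Q.2.1, P.2.2 || Q.2.2)

/-- **The two-hyperedge base** `B(P₁, Q₁)`: the blocks `P`, `Q` each open in exactly one copy,
independently (nine placements; in a common copy they merge into `P ∪ Q`). -/
noncomputable def Btwo (ends : E → Sym2 V) (o a₁ a₂ a₃ b : V) (s₁ s₂ s₃ : E) (F₀ : Finset E)
    (z₀ : Config E) (τ : E → ℕ) (P Q : Bool × Bool × Bool) : R :=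
  patCount ends o a₁ a₂ a₃ b s₁ s₂ s₃ F₀ z₀ τ (orU P Q) (false, false, false) (false, false, false) +
  patCount ends o a₁ a₂ a₃ b s₁ s₂ s₃ F₀ z₀ τ P Q (false, false, false) +
  patCount ends o a₁ a₂ a₃ b s₁ s₂ s₃ F₀ z₀ τ P (false, false, false) Q +
  patCount ends o a₁ a₂ a₃ b s₁ s₂ s₃ F₀ z₀ τ Q P (false, false, false) +
  patCount ends o a₁ a₂ a₃ b s₁ s₂ s₃ F₀ z₀ τ (false, false, false) (orU P Q) (false, false, false) +
  patCount ends o a₁ a₂ a₃ b s₁ s₂ s₃ F₀ z₀ τ (false, false, false) P Q +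
  patCount ends o a₁ a₂ a₃ b s₁ s₂ s₃ F₀ z₀ τ Q (false, false, false) P +
  patCount ends o a₁ a₂ a₃ b s₁ s₂ s₃ F₀ z₀ τ (false, false, false) Q P +
  patCount ends o a₁ a₂ a₃ b s₁ s₂ s₃ F₀ z₀ τ (false, false, false) (false, false, false) (orU P Q)

/-- **The type-`2` hyperedge base** `B(P₂)`: the block `P` open in exactly two copies. -/
noncomputable def Btype2 (ends : E → Sym2 V) (o a₁ a₂ a₃ b : V) (s₁ s₂ s₃ : E) (F₀ : Finset E)
    (z₀ : Config E) (τ : E → ℕ) (P : Bool × Bool × Bool) : R :=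
  patCount ends o a₁ a₂ a₃ b s₁ s₂ s₃ F₀ z₀ τ P P (false, false, false) +
  patCount ends o a₁ a₂ a₃ b s₁ s₂ s₃ F₀ z₀ τ P (false, false, false) P +
  patCount ends o a₁ a₂ a₃ b s₁ s₂ s₃ F₀ z₀ τ (false, false, false) P P

end Defs

section Splits

variable {V : Type*} {E : Type*} [Fintype E] [DecidableEq E] {R : Type*} [Field R]

/-- The split with types `(2, 1, 2)` and `(1, 2, 2)`. -/
theorem typedCount_star_split_out (ends : E → Sym2 V) (o a₁ a₂ a₃ b : V) {s₁ s₂ s₃ : E}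
    (h12 : s₁ ≠ s₂) (h13 : s₁ ≠ s₃) (h23 : s₂ ≠ s₃) (F : Finset E) (hs₁ : s₁ ∈ F) (hs₂ : s₂ ∈ F)
    (hs₃ : s₃ ∈ F) (z : Config E) (τ : E → ℕ) :
    (τ s₁ = 2 → τ s₂ = 1 → τ s₃ = 2 →
      typedCount F z τ (K3 ends o a₁ a₂ a₃ b : Config E → Config E → Config E → R) =
      ∑ p₁ ∈ placements2, ∑ p₂ ∈ placements, ∑ p₃ ∈ placements2,
        patCount ends o a₁ a₂ a₃ b s₁ s₂ s₃ (((F.erase s₁).erase s₂).erase s₃)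
          (Function.update (Function.update (Function.update z s₁ false) s₂ false) s₃ false) τ
          (p₁.1, p₂.1, p₃.1) (p₁.2.1, p₂.2.1, p₃.2.1) (p₁.2.2, p₂.2.2, p₃.2.2)) ∧
    (τ s₁ = 1 → τ s₂ = 2 → τ s₃ = 2 →
      typedCount F z τ (K3 ends o a₁ a₂ a₃ b : Config E → Config E → Config E → R) =
      ∑ p₁ ∈ placements, ∑ p₂ ∈ placements2, ∑ p₃ ∈ placements2,
        patCount ends o a₁ a₂ a₃ b s₁ s₂ s₃ (((F.erase s₁).erase s₂).erase s₃)
          (Function.update (Function.update (Function.update z s₁ false) s₂ false) s₃ false) τ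
          (p₁.1, p₂.1, p₃.1) (p₁.2.1, p₂.2.1, p₃.2.1) (p₁.2.2, p₂.2.2, p₃.2.2)) := by
  have hs₂' : s₂ ∈ F.erase s₁ := Finset.mem_erase.mpr ⟨h12.symm, hs₂⟩
  have hs₃' : s₃ ∈ (F.erase s₁).erase s₂ :=
    Finset.mem_erase.mpr ⟨h23.symm, Finset.mem_erase.mpr ⟨h13.symm, hs₃⟩⟩
  constructor
  · intro hτ₁ hτ₂ hτ₃
    rw [typedCount_split F s₁ hs₁ z τ]
    simp only [hτ₁, sum_bool3_two]
    simp only [typedCount_split (F.erase s₁) s₂ hs₂', hτ₂, sum_bool3_one]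
    simp only [typedCount_split ((F.erase s₁).erase s₂) s₃ hs₃', hτ₃, sum_bool3_two]
    simp only [sum_placements, sum_placements2]
    unfold patCount patKernel starSet
    simp only []
  · intro hτ₁ hτ₂ hτ₃
    rw [typedCount_split F s₁ hs₁ z τ]
    simp only [hτ₁, sum_bool3_one]
    simp only [typedCount_split (F.erase s₁) s₂ hs₂', hτ₂, sum_bool3_two]
    simp only [typedCount_split ((F.erase s₁).erase s₂) s₃ hs₃', hτ₃, sum_bool3_two]
    simp only [sum_placements, sum_placements2]
    unfold patCount patKernel starSet
    simp only []

end Splits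

section Debt

variable {V : Type*} {E : Type*} [Fintype E] [DecidableEq E] {R : Type*} [Field R]
  {ends : E → Sym2 V} {o a₁ a₂ a₃ b : V} {s₁ s₂ s₃ : E} {y u₁ u₂ u₃ : V}

/-- **The `(2,1,2)` debt identity**: `N_(2,1,2) + B(T₁) = B(01₁,02₁) + B(02₁,T₁) + B(02₂) + B(02₁,12₁)`. -/
theorem star_212 (F : Finset E) (z : Config E) (τ : E → ℕ)
    (D : StarData ends o a₁ a₂ a₃ b s₁ s₂ s₃ y u₁ u₂ u₃ (((F.erase s₁).erase s₂).erase s₃)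
      (Function.update (Function.update (Function.update z s₁ false) s₂ false) s₃ false))
    (hs₁ : s₁ ∈ F) (hs₂ : s₂ ∈ F) (hs₃ : s₃ ∈ F) (hτ₁ : τ s₁ = 2) (hτ₂ : τ s₂ = 1)
    (hτ₃ : τ s₃ = 2) :
    typedCount F z τ (K3 ends o a₁ a₂ a₃ b : Config E → Config E → Config E → R) +
      Bone ends o a₁ a₂ a₃ b s₁ s₂ s₃ (((F.erase s₁).erase s₂).erase s₃)
        (Function.update (Function.update (Function.update z s₁ false) s₂ false) s₃ false) τ
        (true, true, true) =
      Btwo ends o a₁ a₂ a₃ b s₁ s₂ s₃ (((F.erase s₁).erase s₂).erase s₃)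
        (Function.update (Function.update (Function.update z s₁ false) s₂ false) s₃ false) τ
        (true, true, false) (true, false, true) +
      Btwo ends o a₁ a₂ a₃ b s₁ s₂ s₃ (((F.erase s₁).erase s₂).erase s₃)
        (Function.update (Function.update (Function.update z s₁ false) s₂ false) s₃ false) τ
        (true, false, true) (true, true, true) +
      Btype2 ends o a₁ a₂ a₃ b s₁ s₂ s₃ (((F.erase s₁).erase s₂).erase s₃)
        (Function.update (Function.update (Function.update z s₁ false) s₂ false) s₃ false) τ
        (true, false, true) +
      Btwo ends o a₁ a₂ a₃ b s₁ s₂ s₃ (((F.erase s₁).erase s₂).erase s₃)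
        (Function.update (Function.update (Function.update z s₁ false) s₂ false) s₃ false) τ
        (true, false, true) (false, true, true) := by
  rw [(typedCount_star_split_out ends o a₁ a₂ a₃ b D.h12 D.h13 D.h23 F hs₁ hs₂ hs₃ z τ).1 hτ₁
    hτ₂ hτ₃]
  simp only [sum_placements, sum_placements2]
  simp only [patCount_close_x D τ (Or.inl rfl), patCount_close_x D τ (Or.inr (Or.inl rfl)),
    patCount_close_x D τ (Or.inr (Or.inr rfl)), patCount_close_y D τ _ (Or.inl rfl),
    patCount_close_y D τ _ (Or.inr (Or.inl rfl)), patCount_close_y D τ _ (Or.inr (Or.inr rfl)),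
    patCount_close_w D τ _ _ (Or.inl rfl), patCount_close_w D τ _ _ (Or.inr (Or.inl rfl)),
    patCount_close_w D τ _ _ (Or.inr (Or.inr rfl))]
  unfold Bone Btwo Btype2
  simp only [orU, Bool.or_true, Bool.or_false]
  ring

/-- **The `(1,2,2)` debt identity**: `N_(1,2,2) + B(T₁) = B(01₁,12₁) + B(12₁,T₁) + B(02₁,12₁) + B(12₂)`. -/
theorem star_122 (F : Finset E) (z : Config E) (τ : E → ℕ)
    (D : StarData ends o a₁ a₂ a₃ b s₁ s₂ s₃ y u₁ u₂ u₃ (((F.erase s₁).erase s₂).erase s₃)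
      (Function.update (Function.update (Function.update z s₁ false) s₂ false) s₃ false))
    (hs₁ : s₁ ∈ F) (hs₂ : s₂ ∈ F) (hs₃ : s₃ ∈ F) (hτ₁ : τ s₁ = 1) (hτ₂ : τ s₂ = 2)
    (hτ₃ : τ s₃ = 2) :
    typedCount F z τ (K3 ends o a₁ a₂ a₃ b : Config E → Config E → Config E → R) +
      Bone ends o a₁ a₂ a₃ b s₁ s₂ s₃ (((F.erase s₁).erase s₂).erase s₃)
        (Function.update (Function.update (Function.update z s₁ false) s₂ false) s₃ false) τ
        (true, true, true) =
      Btwo ends o a₁ a₂ a₃ b s₁ s₂ s₃ (((F.erase s₁).erase s₂).erase s₃)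
        (Function.update (Function.update (Function.update z s₁ false) s₂ false) s₃ false) τ
        (true, true, false) (false, true, true) +
      Btwo ends o a₁ a₂ a₃ b s₁ s₂ s₃ (((F.erase s₁).erase s₂).erase s₃)
        (Function.update (Function.update (Function.update z s₁ false) s₂ false) s₃ false) τ
        (false, true, true) (true, true, true) +
      Btwo ends o a₁ a₂ a₃ b s₁ s₂ s₃ (((F.erase s₁).erase s₂).erase s₃)
        (Function.update (Function.update (Function.update z s₁ false) s₂ false) s₃ false) τ
        (true, false, true) (false, true, true) +
      Btype2 ends o a₁ a₂ a₃ b s₁ s₂ s₃ (((F.erase s₁).erase s₂).erase s₃)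
        (Function.update (Function.update (Function.update z s₁ false) s₂ false) s₃ false) τ
        (false, true, true) := by
  rw [(typedCount_star_split_out ends o a₁ a₂ a₃ b D.h12 D.h13 D.h23 F hs₁ hs₂ hs₃ z τ).2 hτ₁
    hτ₂ hτ₃]
  simp only [sum_placements, sum_placements2]
  simp only [patCount_close_x D τ (Or.inl rfl), patCount_close_x D τ (Or.inr (Or.inl rfl)),
    patCount_close_x D τ (Or.inr (Or.inr rfl)), patCount_close_y D τ _ (Or.inl rfl),
    patCount_close_y D τ _ (Or.inr (Or.inl rfl)), patCount_close_y D τ _ (Or.inr (Or.inr rfl)),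
    patCount_close_w D τ _ _ (Or.inl rfl), patCount_close_w D τ _ _ (Or.inr (Or.inl rfl)),
    patCount_close_w D τ _ _ (Or.inr (Or.inr rfl))]
  unfold Bone Btwo Btype2
  simp only [orU, Bool.or_true, Bool.or_false]
  ring

end Debt

section Debt222

variable {V : Type*} {E : Type*} [Fintype E] [DecidableEq E] {R : Type*} [Field R]
  {ends : E → Sym2 V} {o a₁ a₂ a₃ b : V} {s₁ s₂ s₃ : E} {y u₁ u₂ u₃ : V}

/-- The split with types `(2, 2, 2)`. -/
theorem typedCount_star_split_222 (ends : E → Sym2 V) (o a₁ a₂ a₃ b : V) {s₁ s₂ s₃ : E}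
    (h12 : s₁ ≠ s₂) (h13 : s₁ ≠ s₃) (h23 : s₂ ≠ s₃) (F : Finset E) (hs₁ : s₁ ∈ F) (hs₂ : s₂ ∈ F)
    (hs₃ : s₃ ∈ F) (z : Config E) (τ : E → ℕ) (hτ₁ : τ s₁ = 2) (hτ₂ : τ s₂ = 2) (hτ₃ : τ s₃ = 2) :
    typedCount F z τ (K3 ends o a₁ a₂ a₃ b : Config E → Config E → Config E → R) =
      ∑ p₁ ∈ placements2, ∑ p₂ ∈ placements2, ∑ p₃ ∈ placements2,
        patCount ends o a₁ a₂ a₃ b s₁ s₂ s₃ (((F.erase s₁).erase s₂).erase s₃)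
          (Function.update (Function.update (Function.update z s₁ false) s₂ false) s₃ false) τ
          (p₁.1, p₂.1, p₃.1) (p₁.2.1, p₂.2.1, p₃.2.1) (p₁.2.2, p₂.2.2, p₃.2.2) := by
  have hs₂' : s₂ ∈ F.erase s₁ := Finset.mem_erase.mpr ⟨h12.symm, hs₂⟩
  have hs₃' : s₃ ∈ (F.erase s₁).erase s₂ :=
    Finset.mem_erase.mpr ⟨h23.symm, Finset.mem_erase.mpr ⟨h13.symm, hs₃⟩⟩
  rw [typedCount_split F s₁ hs₁ z τ]
  simp only [hτ₁, sum_bool3_two]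
  simp only [typedCount_split (F.erase s₁) s₂ hs₂', hτ₂, sum_bool3_two]
  simp only [typedCount_split ((F.erase s₁).erase s₂) s₃ hs₃', hτ₃, sum_bool3_two]
  simp only [sum_placements2]
  unfold patCount patKernel starSet
  simp only []

/-- **The three-block base with the blocks in three DISTINCT copies** `B′(P, Q, S)` (the six
orderings). -/
noncomputable def Bthree (ends : E → Sym2 V) (o a₁ a₂ a₃ b : V) (s₁ s₂ s₃ : E) (F₀ : Finset E)
    (z₀ : Config E) (τ : E → ℕ) (P Q S : Bool × Bool × Bool) : R :=
  patCount ends o a₁ a₂ a₃ b s₁ s₂ s₃ F₀ z₀ τ P Q S + patCount ends o a₁ a₂ a₃ b s₁ s₂ s₃ F₀ z₀ τ P S Q +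
  patCount ends o a₁ a₂ a₃ b s₁ s₂ s₃ F₀ z₀ τ Q P S + patCount ends o a₁ a₂ a₃ b s₁ s₂ s₃ F₀ z₀ τ Q S P +
  patCount ends o a₁ a₂ a₃ b s₁ s₂ s₃ F₀ z₀ τ S P Q + patCount ends o a₁ a₂ a₃ b s₁ s₂ s₃ F₀ z₀ τ S Q P

/-- **The `(2,2,2)` debt identity**:
`N_(2,2,2) + 3 B(T₁) = B(01₁,T₁) + B(02₁,T₁) + B(12₁,T₁) + B(T₂) + B′(01, 02, 12)`. -/
theorem star_222 (F : Finset E) (z : Config E) (τ : E → ℕ)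
    (D : StarData ends o a₁ a₂ a₃ b s₁ s₂ s₃ y u₁ u₂ u₃ (((F.erase s₁).erase s₂).erase s₃)
      (Function.update (Function.update (Function.update z s₁ false) s₂ false) s₃ false))
    (hs₁ : s₁ ∈ F) (hs₂ : s₂ ∈ F) (hs₃ : s₃ ∈ F) (hτ₁ : τ s₁ = 2) (hτ₂ : τ s₂ = 2)
    (hτ₃ : τ s₃ = 2) :
    typedCount F z τ (K3 ends o a₁ a₂ a₃ b : Config E → Config E → Config E → R) +
      3 * Bone ends o a₁ a₂ a₃ b s₁ s₂ s₃ (((F.erase s₁).erase s₂).erase s₃)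
        (Function.update (Function.update (Function.update z s₁ false) s₂ false) s₃ false) τ
        (true, true, true) =
      Btwo ends o a₁ a₂ a₃ b s₁ s₂ s₃ (((F.erase s₁).erase s₂).erase s₃)
        (Function.update (Function.update (Function.update z s₁ false) s₂ false) s₃ false) τ
        (true, true, false) (true, true, true) +
      Btwo ends o a₁ a₂ a₃ b s₁ s₂ s₃ (((F.erase s₁).erase s₂).erase s₃)
        (Function.update (Function.update (Function.update z s₁ false) s₂ false) s₃ false) τ
        (true, false, true) (true, true, true) +
      Btwo ends o a₁ a₂ a₃ b s₁ s₂ s₃ (((F.erase s₁).erase s₂).erase s₃)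
        (Function.update (Function.update (Function.update z s₁ false) s₂ false) s₃ false) τ
        (false, true, true) (true, true, true) +
      Btype2 ends o a₁ a₂ a₃ b s₁ s₂ s₃ (((F.erase s₁).erase s₂).erase s₃)
        (Function.update (Function.update (Function.update z s₁ false) s₂ false) s₃ false) τ
        (true, true, true) +
      Bthree ends o a₁ a₂ a₃ b s₁ s₂ s₃ (((F.erase s₁).erase s₂).erase s₃)
        (Function.update (Function.update (Function.update z s₁ false) s₂ false) s₃ false) τ
        (true, true, false) (true, false, true) (false, true, true) := by
  rw [typedCount_star_split_222 ends o a₁ a₂ a₃ b D.h12 D.h13 D.h23 F hs₁ hs₂ hs₃ z τ hτ₁ hτ₂ hτ₃]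
  simp only [sum_placements2]
  simp only [patCount_close_x D τ (Or.inl rfl), patCount_close_x D τ (Or.inr (Or.inl rfl)),
    patCount_close_x D τ (Or.inr (Or.inr rfl)), patCount_close_y D τ _ (Or.inl rfl),
    patCount_close_y D τ _ (Or.inr (Or.inl rfl)), patCount_close_y D τ _ (Or.inr (Or.inr rfl)),
    patCount_close_w D τ _ _ (Or.inl rfl), patCount_close_w D τ _ _ (Or.inr (Or.inl rfl)),
    patCount_close_w D τ _ _ (Or.inr (Or.inr rfl))]
  unfold Bone Btwo Btype2 Bthree
  simp only [orU, Bool.or_true]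
  ring

end Debt222

/-! ## The hard step as a named statement -/

section HardStep

variable {V : Type*} {E : Type*} [Fintype E] [DecidableEq E] {R : Type*} [Field R] [LinearOrder R]
  [IsStrictOrderedRing R] {ends : E → Sym2 V} {o a₁ a₂ a₃ b : V} {s₁ s₂ s₃ : E}

omit [IsStrictOrderedRing R] in
/-- **The located hard step at a `(2,1,2)` star** (LEAD-CCW §3⁗⁗″, the debt form): the four
hypergraph bases of `G − y` dominate the debt `B(T₁)`.
SCOPE (NEG-108): conjectured for the one-rung-down objects of GRAPHS — `(F₀, z₀, τ)` the typed
edges of `G − y`, `G` a finite graph (unmarked vertices allowed), the blocks the pieces of THIS star —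
and for the five-mark base; NOT for typed hypergraphs with unmarked vertices (`H*`: `N = −2`). -/
def HardStep212 (ends : E → Sym2 V) (o a₁ a₂ a₃ b : V) (s₁ s₂ s₃ : E) (F₀ : Finset E)
    (z₀ : Config E) (τ : E → ℕ) : Prop :=
  Bone (R := R) ends o a₁ a₂ a₃ b s₁ s₂ s₃ F₀ z₀ τ (true, true, true) ≤
    Btwo ends o a₁ a₂ a₃ b s₁ s₂ s₃ F₀ z₀ τ (true, true, false) (true, false, true) +
    Btwo ends o a₁ a₂ a₃ b s₁ s₂ s₃ F₀ z₀ τ (true, false, true) (true, true, true) +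
    Btype2 ends o a₁ a₂ a₃ b s₁ s₂ s₃ F₀ z₀ τ (true, false, true) +
    Btwo ends o a₁ a₂ a₃ b s₁ s₂ s₃ F₀ z₀ τ (true, false, true) (false, true, true)

omit [IsStrictOrderedRing R] in
/-- **The located hard step at a `(1,2,2)` star.**
SCOPE (NEG-108): conjectured for the one-rung-down objects of GRAPHS — `(F₀, z₀, τ)` the typed
edges of `G − y`, `G` a finite graph (unmarked vertices allowed), the blocks the pieces of THIS star —
and for the five-mark base; NOT for typed hypergraphs with unmarked vertices (`H*`: `N = −2`). -/
def HardStep122 (ends : E → Sym2 V) (o a₁ a₂ a₃ b : V) (s₁ s₂ s₃ : E) (F₀ : Finset E)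
    (z₀ : Config E) (τ : E → ℕ) : Prop :=
  Bone (R := R) ends o a₁ a₂ a₃ b s₁ s₂ s₃ F₀ z₀ τ (true, true, true) ≤
    Btwo ends o a₁ a₂ a₃ b s₁ s₂ s₃ F₀ z₀ τ (true, true, false) (false, true, true) +
    Btwo ends o a₁ a₂ a₃ b s₁ s₂ s₃ F₀ z₀ τ (false, true, true) (true, true, true) +
    Btwo ends o a₁ a₂ a₃ b s₁ s₂ s₃ F₀ z₀ τ (true, false, true) (false, true, true) +
    Btype2 ends o a₁ a₂ a₃ b s₁ s₂ s₃ F₀ z₀ τ (false, true, true)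

variable {y u₁ u₂ u₃ : V}

/-- **2′TRI at a `(2,1,2)` star IS the hard step**: the typed base is nonnegative iff the debt
inequality holds. -/
theorem typedCount_212_nonneg_iff (F : Finset E) (z : Config E) (τ : E → ℕ)
    (D : StarData ends o a₁ a₂ a₃ b s₁ s₂ s₃ y u₁ u₂ u₃ (((F.erase s₁).erase s₂).erase s₃)
      (Function.update (Function.update (Function.update z s₁ false) s₂ false) s₃ false))
    (hs₁ : s₁ ∈ F) (hs₂ : s₂ ∈ F) (hs₃ : s₃ ∈ F) (hτ₁ : τ s₁ = 2) (hτ₂ : τ s₂ = 1)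
    (hτ₃ : τ s₃ = 2) :
    0 ≤ typedCount F z τ (K3 ends o a₁ a₂ a₃ b : Config E → Config E → Config E → R) ↔
      HardStep212 (R := R) ends o a₁ a₂ a₃ b s₁ s₂ s₃ (((F.erase s₁).erase s₂).erase s₃)
        (Function.update (Function.update (Function.update z s₁ false) s₂ false) s₃ false) τ := by
  have h := star_212 (R := R) F z τ D hs₁ hs₂ hs₃ hτ₁ hτ₂ hτ₃
  unfold HardStep212
  constructor
  · intro h0; linarith
  · intro h0; linarith

/-- **2′TRI at a `(1,2,2)` star IS the hard step.** -/
theorem typedCount_122_nonneg_iff (F : Finset E) (z : Config E) (τ : E → ℕ)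
    (D : StarData ends o a₁ a₂ a₃ b s₁ s₂ s₃ y u₁ u₂ u₃ (((F.erase s₁).erase s₂).erase s₃)
      (Function.update (Function.update (Function.update z s₁ false) s₂ false) s₃ false))
    (hs₁ : s₁ ∈ F) (hs₂ : s₂ ∈ F) (hs₃ : s₃ ∈ F) (hτ₁ : τ s₁ = 1) (hτ₂ : τ s₂ = 2)
    (hτ₃ : τ s₃ = 2) :
    0 ≤ typedCount F z τ (K3 ends o a₁ a₂ a₃ b : Config E → Config E → Config E → R) ↔
      HardStep122 (R := R) ends o a₁ a₂ a₃ b s₁ s₂ s₃ (((F.erase s₁).erase s₂).erase s₃)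
        (Function.update (Function.update (Function.update z s₁ false) s₂ false) s₃ false) τ := by
  have h := star_122 (R := R) F z τ D hs₁ hs₂ hs₃ hτ₁ hτ₂ hτ₃
  unfold HardStep122
  constructor
  · intro h0; linarith
  · intro h0; linarith

end HardStep

end StarPattern

end Summit.Ventures.PercRepro2
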